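import Summits.PneNP.PneNP.Theorems.ExpanderLinearGeneratorsColumnTwoSystem
import Literature.Computability.MetaComplexity.TseitinDepthFregeTransfer
import Literature.Computability.MetaComplexity.XorPHPReduction

/-!
# PneNP / ExpanderLinearGenerators — column weight two: the routing substitution, preparations

Route `PneNP/ExpanderLinearGenerators`, support for crux stmt-PneNP-11443. Given a source system `E`
over `𝔽₂` of column weight `≤ 2`, a target system `E'` in which every variable lies in exactly two
rows, has support `≤ k₀` per row and odd total right-hand side, and inside EVERY odd closed
component of `E` a `K_{m'}` minor model indexed by the target rows, we build ONE substitution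
`σ` on the variables of `E` such that every clause of `sumEncoding 1 E`, after `σ`, is a tautology
or is implied by the `≤ 2^{k₀}` clauses of one target equation, all on the `≤ k₀` variables of that
equation (`exists_routing_subst`, in `…ColumnTwoSigma`) — the hypothesis `hloc` of
`TextbookFrege.transfer_isDepthProofOf`. This file: the parity gadget's semantics/size/depth and
small facts on the sum-encoding used there. The substitution: `σ v = φ v ⊕ ⨁ {y_x : v ∈ J x}`
(`xorForm`), `J x` the joins of `exists_routing` in the component of `v`, and `φ` a Boolean
solution of the system `E` with right-hand sides corrected at the roots by the target charges
(`exists_assignment_of_even`).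

[folklore; Urquhart–Fu 1996, Ben-Sasson 2002 (routing reductions), in minor/`T`-join form]
-/

namespace Summit.PneNP.PneNP.Theorems.ColumnTwo

open Finset Literature.Computability.MetaComplexity Literature.Computability.MetaComplexity.TextbookFrege
open Literature.Computability.Complexity (PropForm Clause CNF Literal)
open Literature.Computability.MetaComplexity.KrajicekRamsey (litOf clauseOf)

variable {m n m' n' : ℕ}

/-! ### The parity gadget -/

/-- Semantics of `parityForm`. [folklore] -/
theorem eval_parityForm (b : Bool) (ρ : ℕ → Bool) :
    ∀ xs : List ℕ, (parityForm b xs).eval ρ = xor b ((xs.map ρ).foldr xor false)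
  | [] => by cases b <;> rfl
  | x :: xs => by
    simp only [parityForm, PropForm.eval, eval_parityForm b ρ xs, List.map_cons, List.foldr_cons]
    cases b <;> cases ρ x <;> cases (xs.map ρ).foldr xor false <;> rfl

/-- Size of `parityForm`: `≤ 9 · 2^{|xs|}`. [folklore] -/
theorem size_parityForm_le (b : Bool) : ∀ xs : List ℕ, (parityForm b xs).size + 8 ≤ 9 * 2 ^ xs.length
  | [] => by simp [parityForm, PropForm.size]
  | x :: xs => by
    have := size_parityForm_le b xs
    simp only [parityForm, PropForm.size, List.length_cons, Nat.pow_succ]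
    omega

/-- Depth of `parityForm`: every auxiliary alternation depth is `≤ 3 |xs|`. [folklore] -/
theorem altDepthAux_parityForm_le (b : Bool) :
    ∀ (xs : List ℕ) (c : ℕ), PropForm.altDepthAux c (parityForm b xs) ≤ 3 * xs.length
  | [], c => Nat.zero_le _
  | x :: xs, c => by
    have h1 := altDepthAux_parityForm_le b xs 1
    have h2 := altDepthAux_parityForm_le b xs 2
    have e1 : (if (2 : ℕ) = 1 then (0 : ℕ) else 1) = 1 := by decide
    have e2 : (if (3 : ℕ) = 2 then (0 : ℕ) else 1) = 1 := by decide
    have hc : (if c = 3 then 0 else 1) ≤ 1 := by split_ifs <;> omega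
    simp only [parityForm, PropForm.altDepthAux, List.length_cons, e1, e2]
    generalize (if c = 3 then 0 else 1) = i at *
    omega

/-- Variables of `parityForm`. [folklore] -/
theorem mem_vars_parityForm {b : Bool} {xs : List ℕ} {y : ℕ} (h : y ∈ (parityForm b xs).vars) :
    y ∈ xs := by
  induction xs with
  | nil => simp [parityForm, PropForm.vars] at h
  | cons x xs ih =>
    simp only [parityForm, PropForm.vars, Finset.mem_union, Finset.mem_singleton] at h
    rcases h with (rfl | h) | (rfl | h)
    · simp
    · exact List.mem_cons_of_mem _ (ih h)
    · simp
    · exact List.mem_cons_of_mem _ (ih h)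

/-! ### Small facts -/

/-- Parity of an iterated `xor`, in `𝔽₂`. [folklore] -/
theorem ite_foldr_xor (L : List Bool) :
    (if L.foldr xor false then (1 : ZMod 2) else 0) = (L.map fun c => if c then (1 : ZMod 2) else 0).sum := by
  induction L with
  | nil => simp
  | cons c L ih =>
    rw [List.foldr_cons, List.map_cons, List.sum_cons, ← ih]
    cases c <;> cases L.foldr xor false <;> decide

/-- Semantics of `parityForm` in `𝔽₂`: `[parityForm b xs] = [b] + Σ_{x ∈ xs} [τ x]`. [folklore] -/
theorem ite_eval_parityForm (b : Bool) (xs : List ℕ) (τ : ℕ → Bool) :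
    (if (parityForm b xs).eval τ then (1 : ZMod 2) else 0) =
      (if b then 1 else 0) + (xs.map fun x => if τ x then (1 : ZMod 2) else 0).sum := by
  have e : (xs.map fun x => if τ x then (1 : ZMod 2) else 0) =
      (xs.map τ).map (fun c => if c then (1 : ZMod 2) else 0) := by rw [List.map_map]; rfl
  rw [eval_parityForm, e, ← ite_foldr_xor]
  cases b <;> cases (List.map τ xs).foldr xor false <;> decide

/-- `Holds` under a Boolean assignment (`B = 1`), as a sum of indicator values. [folklore] -/
theorem holds_blockVals_iff (e : LinEqMod 2 n) (ψ : ℕ → Bool) :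
    e.Holds (blockVals 2 1 n ψ) ↔ ∑ j, e.1 j * (if ψ j then 1 else 0) = e.2 := by
  unfold LinEqMod.Holds
  simp only [blockVals_two_one_apply]

/-- The coefficient of a variable in the support is `1`, else `0` (`𝔽₂`). [folklore] -/
theorem coeff_eq_ite (e : LinEqMod 2 n) (j : Fin n) : e.1 j = if j ∈ e.supp then 1 else 0 := by
  by_cases h : j ∈ e.supp
  · rw [if_pos h]; exact ((by decide : ∀ a : ZMod 2, a ≠ 0 → a = 1) _ (Finset.mem_filter.1 h).2)
  · rw [if_neg h]; by_contra h'; exact h (Finset.mem_filter.2 ⟨Finset.mem_univ _, h'⟩)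

/-- A sum against the coefficients is a sum over the support. [folklore] -/
theorem sum_coeff_mul (e : LinEqMod 2 n) (f : Fin n → ZMod 2) :
    ∑ j, e.1 j * f j = ∑ j ∈ e.supp, f j := by
  simp_rw [coeff_eq_ite, ite_mul, one_mul, zero_mul]
  rw [Finset.sum_ite_mem, Finset.univ_inter]

/-- The canonical CNF of a list of `L` variables has at most `2^L` clauses. [folklore] -/
theorem length_equationCNF_le (e : LinEqMod 2 n') : (equationCNF 1 e).length ≤ 2 ^ e.supp.card := by
  unfold equationCNF canonicalCNF
  rw [List.length_map]
  refine (List.length_filter_le _ _).trans ?_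
  rw [List.length_sublists, length_eqVars, mul_one]

/-- The variables of a clause of `equationCNF 1 e` are (numbers of) variables of the support.
[folklore] -/
theorem exists_mem_supp_of_mem_vars {e : LinEqMod 2 n} {c : Clause ℕ} (hc : c ∈ equationCNF 1 e)
    {y : ℕ} (hy : y ∈ (clauseOf c).vars) : ∃ j ∈ e.supp, y = (j : ℕ) := by
  obtain ⟨l, hl, rfl⟩ := OntoPHPReduction.exists_of_mem_vars_clauseOf hy
  have := fst_mem_of_mem_canonicalCNF hc hl
  obtain ⟨j, hj, hlj⟩ := mem_eqVars.1 this
  obtain ⟨j0, hj0, hl1⟩ := mem_encBlock.1 hlj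
  exact ⟨j, hj, by omega⟩

end Summit.PneNP.PneNP.Theorems.ColumnTwo
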